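import Summits.QuantumFields.BalabanUV.T4Continuum.Support.NE9CurChartTowerPiOneChartClassW80
import Summits.QuantumFields.BalabanUV.T4Continuum.Support.NE9CurChartTowerPiLatticeUniformFlatWitness

/-!
# NE9CurChartTowerPiOneChartClassW80TopLevel — (TOP-LEVEL (115) PROFILE `lev ≡ n+1`, `ω = Ω = 1`) ONE `k`-LEVEL `cur U` CHART WITH THE GENUINE (L3) SLOT ON PRINT's UNITARY
# SMALL-FIELD CLASS: (Ψ1)–(Ψ3) AT `U`, (Ψ1)–(Ψ3) AT THE VACUUM, THE LIPSCHITZ MODULUS AT THE FLAT POINT — SAME RADII, EVERY LATTICE OF THE TOWER, NOTHING DISPLAYED BUT THE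
# CLASS, THE DIAGONAL BOOKKEEPING AND THE HEIGHT-FREE NUMERICS; the sibling `NE9CurChartTowerPiOneChartClassW80` (this seat, gen 106) at the constant level maps `n+1`
# (`NE9CurChartTowerPiLatticeUniformFlatWitness.topLevel_weights` ∕ `zeroExp_weights`); cell `pub-balaban`, T4-DAG §2 node U3 ∕ §6 NE9, WALL-NE9-P1 §3 (ii)∕(vii); NE9
# crux-team (2) LEAF PROVER 01 (`b2b-balaban-t4-ne9-formalise-leaf-01`, gen 106); bears_on R4/N22; nothing printed asserted

HONEST FRAMING (T4-DAG PAGE 1).  Rung (B)+1 of the FINITE-VOLUME T⁴ programme — NOT infinite volume, NOT a mass gap, NOT the Clay problem.  NE9 is a cell NEW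
ESTIMATE, NOT PRINTED in [Balaban1987RG1] ∕ [Balaban1988RG2Cluster], NOT PROVED here («NE9 ⇐ the named binders»; spine PROVED 0∕9).  HONEST DEPENDENCY (cell
line, verbatim): continuum YM on T⁴ ⇐ BetaPertH ∧ nine spine estimates (0/9 proved); BetaPertH ⇐ (D1) ∧ (D4) ∧ CAP+tail; G-an2-4 gates asym, D1 and NE2/3/4.
WHAT THIS FILE PROVES (ONE theorem; 0 def, 0 sorry; composition BY NAME).  **`cur_chart_tower_pi_one_chart_of_unitary_class_topLevel_W80`**: the sibling at `ω = Ω = 1`,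
`lev₀ = lev₁ ≡ n+1`, ANY `levB`: `∃ α₁ j₁ ε₄ ε_C R_b R′ K > 0` BEFORE `∀ n η m U` — the ∀-block is print's class, the diagonal bookkeeping and `levB` ONLY; `∃ h52 hpos′ hposπ
hpos₁` PRODUCED; then for every `Φ_U = chart_U`, `Φ_1 = chart_1`: the two triples on `ball 0 R_b` into `ball 0 R′` and `‖ι(Φ_U B) − Φ_1 B‖ ≤ K·(j₀ + α)` for `‖B‖ < R_b`.
DISGUISE TEST: one application of the sibling; no inequality of the series proved HERE; constants crude; `j₀`, `α` displayed separately; NOT the gauge step of p. 416, NOT a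
general two-background pair, NOT claimed that Bałaban's 𝐇_k ∕ U_j(□₀, exp iB) meet these letters (O-NE9-1; #5 UNRULED); not NE9.
References (TYPES ∕ loci only): [Balaban1985Variational] (27)–(28) p. 282, (44)–(47) p. 285, Prop. 4 (97)–(98) p. 293, (115) p. 294, Prop. 6 (116)–(121) p. 295,
(174)–(175) p. 305; [Balaban1985BackgroundPropagators] (3.35)–(3.37) p. 396, (3.122)–(3.126) p. 420, (3.153) p. 426, Thm 3.13 p. 426; [Balaban1985Averaging] Prop. 2
(52)–(54) p. 26, Prop. 5 p. 42, Proposition 7 p. 43.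
-/

noncomputable section

open Metric Set

namespace Summit.QuantumFields.BalabanUV.T4Continuum.NE9CurChartTowerPiOneChartClassW80TopLevel

open scoped InnerProductSpace ComplexConjugate BigOperators
open Literature.MathematicalPhysics.QuantumFieldTheory.Balaban1983to89
open B11Eq103H1Complex B11Eq115Space B11Eq174Chart
open B11Eq111FrakG (nabla115 jetLinearEquiv)  open B13Contraction113 (QuadAnalytic)
open B9SectCLatticeCarrier (Bond bpos btgt shift unshift)  open B4Sect5Torus (TSite)
open B7Prop1Explicit (U1 Wcx boxVec)  open B7Prop2Explicit (pdev AvgClosed C0 c2' unitaryUnits avgClosed_unitaryUnits unitaryUnits_le_U1 avgIter_zero)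
open B7Prop3Flat (c3)  open B7Prop5GeneralLevels (thetaGen C3Gen)
open B7Prop5CplxLevels (epsCplx tauCplx C3Cplx)  open B9Eq315QTorus (perCfg cornerSite perSite perCfg_apply)
open B9Eq315QTower (towerP UlevOf)  open B9Eq315QTowerFlat (perCfg_UlevOf_one_mem_U1 norm_Wcx_UlevOf_one_sub_one_le UlevOf_one QkW_one_surjective)
open B9Eq326OperatorTower (QkW QkW_surjective laplaceAk RofUk)  open B9Eq310HessianOperator (adTransportW hessOp)
open B9Eq310DeltaPrime (plaqHolU plaqHolU_one)  open B9Eq324DeltaPrimeATower (laplacePrimeAk)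
open B9Eq3119DeltaPiTower (laplaceAkPi)  open B11Eq44COperatorTower (αT αT_le ulev_mem_U1_of_pdev)
open B11Eq44COperatorTowerGeometric (ulev_reg_of_pdev_geometric geomProfile_le_αT)  open B11Eq44CLetterTower (Cck prop4Hyp_Cck analyticOnNhd_Cck)
open B9Thm311SmallFieldClosed (hRS_of_unitary)  open B9Eq315QTorusOnto (liftSite perSite_liftSite)
open B7Eq43AveragedSmallnessLevelFree (pdev_perCfg_le_of_plaq)  open B7Eq43AveragedSmallnessLinearFeed (twoWindows_linear_feed)
open B9Thm311SitePrimeFormCoerciveTowerCanonical (exists_strong_site_coercive_tower_diagonal)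
open B9Thm311LaplaceAkPiPositiveDiagonal (exists_laplaceAkPi_pos_diagonal_closed)  open B9Thm311LaplaceAkPositiveDiagonal (exists_laplaceAk_pos_diagonal_closed)
open B9Eq326OperatorTowerRealityUnitary (UlevOf_star_eq_inv forall_star_eq_inv_of_mem)  open B9Eq342GreenPrimeSupBound (norm_adTransportW_eq)
open B9Eq3119DeltaPiCarrier (currentCLM)  open B11Eq98V0primeCurrentSlots (rieszτ rieszτ_apply)
open B11Eq98CurrentSlot (Jcur)  open B11Eq28JcurWindow (norm_Jcur_le_of_window levWeight_three_le)
open B11Eq80Current (W80 analyticOnNhd_W80_lt)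
open B11Eq63V0GroupCurrent (curV0)  open B11Ineq88KernelLettersFlatChain (J_flat_le_zero)
open Summit.QuantumFields.BalabanUV.T4Continuum.NE9CurChartTowerPiOneChartClassW80 (cur_chart_tower_pi_one_chart_of_unitary_class_lattice_uniform_W80)
open Summit.QuantumFields.BalabanUV.T4Continuum.NE9CurChartTowerPiLatticeUniformFlatWitness (topLevel_weights zeroExp_weights)

variable {d : ℕ} (hd : 1 ≤ d) (L : ℕ) [NeZero L] (hL : 1 ≤ L) (hL2 : 2 ≤ L) (hL3 : 3 ≤ L) [Fact (0 < (L : ℝ))]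
  {𝔸 : Type*} [CStarAlgebra 𝔸] [Nontrivial 𝔸] [FiniteDimensional ℂ 𝔸]
  {W : Type*} [NormedAddCommGroup W] [InnerProductSpace ℂ W] [FiniteDimensional ℂ W] (φ : W ≃ₗ[ℂ] 𝔸)
  {Mφ Mφ' : ℝ} (hMφ : 0 ≤ Mφ) (hMφ' : 0 ≤ Mφ') (hφ : ∀ w, ‖φ w‖ ≤ Mφ * ‖w‖) (hφ' : ∀ X, ‖φ.symm X‖ ≤ Mφ' * ‖X‖)
  {a : ℝ} (ha : 0 < a) {a' : ℝ} (ha' : 0 < a')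
  (τ : 𝔸 →ₗ[ℂ] ℂ) {Cτ : ℝ} (hτ : ∀ X, ‖τ X‖ ≤ Cτ * ‖X‖) (hCτ : 0 ≤ Cτ) {Mτ : ℝ} (hτm : ∀ X Y : 𝔸, ‖τ (X * Y)‖ ≤ Mτ * ‖X‖ * ‖Y‖) (hMτ : 0 ≤ Mτ)
  {ρw : ℝ} (hρw : 0 ≤ ρw)
  (hτ₁ : ∀ X : 𝔸, τ (star X) = conj (τ X)) (hτ₂ : ∀ X Y : 𝔸, τ (X * Y) = τ (Y * X)) (hφτ : ∀ X Y : 𝔸, ⟪φ.symm X, φ.symm Y⟫_ℂ = τ (star X * Y))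
  {α₀ : ℝ} (hα₀ : 0 < α₀) (hα3 : C0 d * α₀ ≤ 1 / 3) (hα4 : 4 * α₀ ≤ c2' d L) (hα8 : 8 * α₀ ≤ c2' d L)
  (hαL : 50 * (d + 1) * αT d L α₀ * (L : ℝ) ^ d ≤ 1 / 2)
  {ρ : ℝ} (hρ0 : 0 < ρ) (hρ : Real.exp (4 * (800 * ((d : ℝ) + 1) ^ 2 * ((d : ℝ) + 4)) * α₀) * (1 + 8 * (131072 * ((d : ℝ) + 1) ^ 2) * ρ) ≤ 2)
  (hρ4 : 4 * ρ ≤ c3 d L) (hθ : 2 * d * thetaGen d L α₀ ≤ (L : ℝ) ^ 3 / 16) (hC3 : 2 * d * C3Gen d L * ρ ≤ 1)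
  (hCτ1 : Cτ ≤ 1)
  {r' : ℝ} (hr' : 0 < r')
  (h7s' : Real.exp (4 * (800 * ((d : ℝ) + 1) ^ 2 * ((d : ℝ) + 4)) * α₀) * (1 + 8 * (131072 * ((d : ℝ) + 1) ^ 2) * r') ≤ 2)
  (h7c' : 2 * r' ≤ c3 d L) (h7r'1 : 409600 * ((d : ℝ) + 1) ^ 2 * r' ≤ 1)
  (h7s : Real.exp (4480 * ((d : ℝ) + 1) ^ 2 * ((d : ℝ) + 4) * α₀ + 240000 * ((d : ℝ) + 1) ^ 3 * r') * (1 + 8 * (2097152 * ((d : ℝ) + 1) ^ 2) * ρ) ≤ 2)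
  (h7c : 16 * ρ < c3 d L) (h7β : (d : ℝ) * C3Cplx d L * ρ ≤ 1)
  -- [B7] Prop. 5's complex numerics, HEIGHT-FREE (their values at `b′ := r′∕L^{n+1}`, `j = k = n+1` equal these)
  (h7E : epsCplx d L r' 0 ≤ 1 / 16) (h7dX : (d : ℝ) * (epsCplx d L r' 0 + tauCplx d L α₀ 0 r' 0) ≤ 1 / 16)

-- deep definitional unfolding `laplaceAkPi` ↦ `laplaceALatticeK … (π†Δπ) …` in the statement (as the host)
set_option maxRecDepth 8192 in
set_option maxHeartbeats 6400000 in -- the sibling applied once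
include hd hL2 hL3 hMφ hMφ' hφ hφ' ha ha' hτ hCτ hτm hMτ hρw hτ₁ hτ₂ hφτ hα₀ hα3 hα4 hα8 hαL hρ0 hρ hρ4 hθ hC3 hCτ1 hr' h7s' h7c' h7r'1 h7s h7c h7β h7E h7dX in
/-- **ONE `cur U` CHART FOR EVERY BACKGROUND OF PRINT's CLASS AND EVERY LATTICE — TWO TRIPLES AND THE FLAT-POINT MODULUS, NOTHING ELSE DISPLAYED**: the sibling at
`ω = Ω = 1` and the constant level maps `n+1` (`topLevel_weights`, `zeroExp_weights`). [folklore]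
[cite: Balaban1985Variational, Prop. 6 (116)–(121) p.295, (174)–(175) p.305, Prop. 4 (97)–(98) pp.292–293, (44)–(47) p.285, (115) p.294; Balaban1985BackgroundPropagators, (3.35)–(3.37) p.396, (3.122) p.420, (3.153) p.426, Thm 3.13 p.426; Balaban1985Averaging, Prop. 2 (52)–(54) p.26, Proposition 7 p.43] -/
theorem cur_chart_tower_pi_one_chart_of_unitary_class_topLevel_W80 :
    ∃ α₁ j₁ ε₄ εC Rb R' K : ℝ, 0 < α₁ ∧ 0 < j₁ ∧ 0 < ε₄ ∧ 0 < εC ∧ 0 < Rb ∧ 0 < R' ∧ 0 < K ∧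
      ∀ (n : ℕ) (η : ℝ) [Fact (0 < η)] (hηL : η * (L : ℝ) ^ (n + 1) = 1) (c₀ c₁ : ℝ) [Fact (0 < c₀)] [Fact (0 < c₁)]
        (_hw : c₀ * ((L : ℝ) ^ (n + 1)) ^ d = c₁) (_hc₀η : c₀ = η ^ d) (_hρ : |η| ^ d / c₀ ≤ ρw) (m : Fin d → ℕ) [∀ i, NeZero (m i)] (_hm : ∀ i, 1 ≤ m i)
        (U : Bond d (towerP L m (n + 1)) → 𝔸ˣ) (hUG : ∀ (x : B7Prop1Explicit.Site d) (κ : Fin d), perCfg (towerP L m (n + 1)) U x κ ∈ unitaryUnits 𝔸)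
        (α : ℝ) (_hα : 0 ≤ α) (_hαle : α ≤ α₁) (_hUη : ∀ b, ‖(U b : 𝔸) - 1‖ ≤ α * η)
        (_hUw : ∀ (x : TSite d (towerP L m (n + 1))) (μ ν : Fin d), ‖(U (shift ν x, μ) : 𝔸) - (U (x, μ) : 𝔸)‖ ≤ α * η ^ 2)
        (_hpl : ∀ p : B9SectCLatticeCarrier.Plaq d (towerP L m (n + 1)), ‖(plaqHolU U p : 𝔸) - 1‖ ≤ α * η ^ 2)
        (_hUgrad : ∀ (x : TSite d (towerP L m (n + 1))) (μ : Fin d), ‖(U (x, μ) : 𝔸) - U (unshift μ x, μ)‖ ≤ α * η ^ 2)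
        (j₀ : ℝ) (_hJ : ∀ μ y, ‖B9Eq39Adjoint.J (fun μ => B9Eq33CovDerivVector.shiftEquiv μ) (fun μ y => U (y, μ)) η μ y‖ ≤ j₀) (_hj : j₀ ≤ j₁)
        (levB : Bond d m → ℕ),
      ∃ h52 : pdev (perCfg (towerP L m (n + 1)) U) < α₀ * (((L : ℝ) ^ (n + 1))⁻¹) ^ 2,
      ∃ hpos' : ∀ x : SiteL2K ℂ d (towerP L m (n + 1)) c₀ W, x ≠ 0 →
          0 < RCLike.re ⟪x, laplacePrimeAk L m n φ η U a' (c₁ := c₁) x⟫_ℂ,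
      ∃ hposπ : ∀ x : BondL2K ℂ d (towerP L m (n + 1)) c₀ W, x ≠ 0 →
          0 < RCLike.re ⟪x, laplaceAkPi L m n φ τ η U a' hpos' hL (fun j => αT d L α₀ * (((L : ℝ) ^ min (j + 1) (n + 1))⁻¹) ^ 2)
            (fun j => (geomProfile_le_αT (d := d) L (n + 1) hL hα₀.le j).trans (αT_le hL hα4))
            (ulev_mem_U1_of_pdev L m (n + 1) U hL2 (avgClosed_unitaryUnits d L) hUG hα₀ hα3 hα4 h52)
            (ulev_reg_of_pdev_geometric L m (n + 1) U hL2 (avgClosed_unitaryUnits d L) hUG hα₀ hα3 hα4 h52) (c₁ := c₁) a x⟫_ℂ,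
      ∃ hpos₁ : ∀ x : BondL2K ℂ d (towerP L m (n + 1)) c₀ W, x ≠ 0 →
          0 < RCLike.re ⟪x, laplaceAk L m n φ η (fun _ : Bond d (towerP L m (n + 1)) => (1 : 𝔸ˣ)) hL (fun _ => 0) (fun _ => by norm_num)
            (perCfg_UlevOf_one_mem_U1 L m (n + 1)) (norm_Wcx_UlevOf_one_sub_one_le L m (n + 1) (fun _ => 0) (fun _ => le_rfl)) τ
            (c₀ := c₀) (c₁ := c₁) a x⟫_ℂ,
      ∀ (ΦU : NegSize (L : ℝ) η levB 0 𝔸 → Space115 (L : ℝ) η (fun _ : Bond d (towerP L m (n + 1)) => n + 1) (fun _ : Bond d (towerP L m (n + 1)) × Fin d => n + 1) (nabla115 η U))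
        (Φ1 : NegSize (L : ℝ) η levB 0 𝔸 → Space115 (L : ℝ) η (fun _ : Bond d (towerP L m (n + 1)) => n + 1) (fun _ : Bond d (towerP L m (n + 1)) × Fin d => n + 1) (nabla115 η (fun _ : Bond d (towerP L m (n + 1)) => (1 : 𝔸ˣ)))),
        ΦU =
          chartHB (frakGLatticeCLM (lev₀ := (fun _ : Bond d (towerP L m (n + 1)) => n + 1)) φ hposπ
                (QkW_surjective L m n φ U hL _ _ _ _ fun j => le_trans (mul_le_mul_of_nonneg_right (mul_le_mul_of_nonneg_left
                  (geomProfile_le_αT (d := d) L (n + 1) hL hα₀.le j) (by positivity)) (by positivity)) hαL) (fun _ : Bond d (towerP L m (n + 1)) × Fin d => n + 1) (nabla115 η U))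
              0 (W80 (rieszτ φ) (LinearMap.toContinuousLinearMap τ) U (H1LatticeCLM (lev₀ := (fun _ : Bond d (towerP L m (n + 1)) => n + 1)) (levB := levB) φ hposπ
                (QkW_surjective L m n φ U hL _ _ _ _ fun j => le_trans (mul_le_mul_of_nonneg_right (mul_le_mul_of_nonneg_left
                  (geomProfile_le_αT (d := d) L (n + 1) hL hα₀.le j) (by positivity)) (by positivity)) hαL) (fun _ : Bond d (towerP L m (n + 1)) × Fin d => n + 1) (nabla115 η U))
                (Cck L m η (n + 1) U (fun _ : Bond d (towerP L m (n + 1)) => n + 1) (fun _ : Bond d (towerP L m (n + 1)) × Fin d => n + 1) (nabla115 η U) levB) εC (Jcur (L := (L : ℝ)) (η := η) (lev₀ := (fun _ : Bond d (towerP L m (n + 1)) => n + 1)) U)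
                (currentCLM φ (fun _ : Bond d (towerP L m (n + 1)) × Fin d => n + 1) (nabla115 η U)
                  (laplaceAkPi L m n φ τ η U a' hpos' hL (fun j => αT d L α₀ * (((L : ℝ) ^ min (j + 1) (n + 1))⁻¹) ^ 2)
                      (fun j => (geomProfile_le_αT (d := d) L (n + 1) hL hα₀.le j).trans (αT_le hL hα4))
                      (ulev_mem_U1_of_pdev L m (n + 1) U hL2 (avgClosed_unitaryUnits d L) hUG hα₀ hα3 hα4 h52)
                      (ulev_reg_of_pdev_geometric L m (n + 1) U hL2 (avgClosed_unitaryUnits d L) hUG hα₀ hα3 hα4 h52) (c₁ := c₁) a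
                    - LinearMap.adjoint (QkW L m n φ U hL (fun j => αT d L α₀ * (((L : ℝ) ^ min (j + 1) (n + 1))⁻¹) ^ 2)
                      (fun j => (geomProfile_le_αT (d := d) L (n + 1) hL hα₀.le j).trans (αT_le hL hα4))
                      (ulev_mem_U1_of_pdev L m (n + 1) U hL2 (avgClosed_unitaryUnits d L) hUG hα₀ hα3 hα4 h52)
                      (ulev_reg_of_pdev_geometric L m (n + 1) U hL2 (avgClosed_unitaryUnits d L) hUG hα₀ hα3 hα4 h52) (c₀ := c₀) (c₁ := c₁)) ∘ₗ
                        ((a : ℂ) • QkW L m n φ U hL (fun j => αT d L α₀ * (((L : ℝ) ^ min (j + 1) (n + 1))⁻¹) ^ 2)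
                      (fun j => (geomProfile_le_αT (d := d) L (n + 1) hL hα₀.le j).trans (αT_le hL hα4))
                      (ulev_mem_U1_of_pdev L m (n + 1) U hL2 (avgClosed_unitaryUnits d L) hUG hα₀ hα3 hα4 h52)
                      (ulev_reg_of_pdev_geometric L m (n + 1) U hL2 (avgClosed_unitaryUnits d L) hUG hα₀ hα3 hα4 h52) (c₀ := c₀) (c₁ := c₁))))) 0 (fun A' => A' + solA (H1LatticeCLM (lev₀ := (fun _ : Bond d (towerP L m (n + 1)) => n + 1)) (levB := levB) φ hposπ
                (QkW_surjective L m n φ U hL _ _ _ _ fun j => le_trans (mul_le_mul_of_nonneg_right (mul_le_mul_of_nonneg_left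
                  (geomProfile_le_αT (d := d) L (n + 1) hL hα₀.le j) (by positivity)) (by positivity)) hαL) (fun _ : Bond d (towerP L m (n + 1)) × Fin d => n + 1) (nabla115 η U)) 0
                (Cck L m η (n + 1) U (fun _ : Bond d (towerP L m (n + 1)) => n + 1) (fun _ : Bond d (towerP L m (n + 1)) × Fin d => n + 1) (nabla115 η U) levB) 0 εC A') ε₄
              (H1LatticeCLM (lev₀ := (fun _ : Bond d (towerP L m (n + 1)) => n + 1)) (levB := levB) φ hposπ
                (QkW_surjective L m n φ U hL _ _ _ _ fun j => le_trans (mul_le_mul_of_nonneg_right (mul_le_mul_of_nonneg_left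
                  (geomProfile_le_αT (d := d) L (n + 1) hL hα₀.le j) (by positivity)) (by positivity)) hαL) (fun _ : Bond d (towerP L m (n + 1)) × Fin d => n + 1) (nabla115 η U)) →
        Φ1 =
          chartHB (frakGLatticeCLM (L := (L : ℝ)) (η := η) (lev₀ := (fun _ : Bond d (towerP L m (n + 1)) => n + 1)) (c := ((η : ℂ))⁻¹)
              (R := adTransportW φ (fun _ : Bond d (towerP L m (n + 1)) => (1 : 𝔸ˣ)))
              (S := adTransportW φ fun _ : Bond d (towerP L m (n + 1)) => (1 : 𝔸ˣ)⁻¹) (Δ₁ := hessOp φ η (fun _ : Bond d (towerP L m (n + 1)) => (1 : 𝔸ˣ)) τ)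
              (Rr := RofUk L m n φ η (fun _ : Bond d (towerP L m (n + 1)) => (1 : 𝔸ˣ)))
              (Q := (QkW L m n φ (fun _ : Bond d (towerP L m (n + 1)) => (1 : 𝔸ˣ)) hL (fun _ => 0) (fun _ => by norm_num)
                (perCfg_UlevOf_one_mem_U1 L m (n + 1)) (norm_Wcx_UlevOf_one_sub_one_le L m (n + 1) (fun _ => 0) (fun _ => le_rfl)) (c₀ := c₀) (c₁ := c₁))) (a := a)
              φ hpos₁ (QkW_one_surjective L m hL n φ) (fun _ : Bond d (towerP L m (n + 1)) × Fin d => n + 1) (nabla115 η (fun _ : Bond d (towerP L m (n + 1)) => (1 : 𝔸ˣ)))) 0 (W80 (rieszτ φ) (LinearMap.toContinuousLinearMap τ) (fun _ : Bond d (towerP L m (n + 1)) => (1 : 𝔸ˣ))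
              (H1LatticeCLM (L := (L : ℝ)) (η := η) (lev₀ := (fun _ : Bond d (towerP L m (n + 1)) => n + 1)) (levB := levB) (c := ((η : ℂ))⁻¹)
              (R := adTransportW φ (fun _ : Bond d (towerP L m (n + 1)) => (1 : 𝔸ˣ)))
              (S := adTransportW φ fun _ : Bond d (towerP L m (n + 1)) => (1 : 𝔸ˣ)⁻¹) (Δ₁ := hessOp φ η (fun _ : Bond d (towerP L m (n + 1)) => (1 : 𝔸ˣ)) τ)
              (Rr := RofUk L m n φ η (fun _ : Bond d (towerP L m (n + 1)) => (1 : 𝔸ˣ)))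
              (Q := (QkW L m n φ (fun _ : Bond d (towerP L m (n + 1)) => (1 : 𝔸ˣ)) hL (fun _ => 0) (fun _ => by norm_num)
                (perCfg_UlevOf_one_mem_U1 L m (n + 1)) (norm_Wcx_UlevOf_one_sub_one_le L m (n + 1) (fun _ => 0) (fun _ => le_rfl)) (c₀ := c₀) (c₁ := c₁))) (a := a)
              φ hpos₁ (QkW_one_surjective L m hL n φ) (fun _ : Bond d (towerP L m (n + 1)) × Fin d => n + 1) (nabla115 η (fun _ : Bond d (towerP L m (n + 1)) => (1 : 𝔸ˣ))))
              (Cck L m η (n + 1) (fun _ : Bond d (towerP L m (n + 1)) => (1 : 𝔸ˣ)) (fun _ : Bond d (towerP L m (n + 1)) => n + 1) (fun _ : Bond d (towerP L m (n + 1)) × Fin d => n + 1) (nabla115 η (fun _ : Bond d (towerP L m (n + 1)) => (1 : 𝔸ˣ))) levB) εC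
              (Jcur (L := (L : ℝ)) (η := η) (lev₀ := (fun _ : Bond d (towerP L m (n + 1)) => n + 1)) (fun _ : Bond d (towerP L m (n + 1)) => (1 : 𝔸ˣ)))
              (currentCLM φ (fun _ : Bond d (towerP L m (n + 1)) × Fin d => n + 1) (nabla115 η (fun _ : Bond d (towerP L m (n + 1)) => (1 : 𝔸ˣ)))
                (laplaceAk L m n φ η (fun _ : Bond d (towerP L m (n + 1)) => (1 : 𝔸ˣ)) hL (fun _ => 0) (fun _ => by norm_num)
                    (perCfg_UlevOf_one_mem_U1 L m (n + 1)) (norm_Wcx_UlevOf_one_sub_one_le L m (n + 1) (fun _ => 0) (fun _ => le_rfl)) τ (c₀ := c₀) (c₁ := c₁) a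
                  - LinearMap.adjoint (QkW L m n φ (fun _ : Bond d (towerP L m (n + 1)) => (1 : 𝔸ˣ)) hL (fun _ => 0) (fun _ => by norm_num)
                      (perCfg_UlevOf_one_mem_U1 L m (n + 1)) (norm_Wcx_UlevOf_one_sub_one_le L m (n + 1) (fun _ => 0) (fun _ => le_rfl)) (c₀ := c₀) (c₁ := c₁)) ∘ₗ
                      ((a : ℂ) • (QkW L m n φ (fun _ : Bond d (towerP L m (n + 1)) => (1 : 𝔸ˣ)) hL (fun _ => 0) (fun _ => by norm_num)
                        (perCfg_UlevOf_one_mem_U1 L m (n + 1)) (norm_Wcx_UlevOf_one_sub_one_le L m (n + 1) (fun _ => 0) (fun _ => le_rfl)) (c₀ := c₀) (c₁ := c₁)))))) 0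
            (fun A' => A' + solA (H1LatticeCLM (L := (L : ℝ)) (η := η) (lev₀ := (fun _ : Bond d (towerP L m (n + 1)) => n + 1)) (levB := levB) (c := ((η : ℂ))⁻¹)
              (R := adTransportW φ (fun _ : Bond d (towerP L m (n + 1)) => (1 : 𝔸ˣ)))
              (S := adTransportW φ fun _ : Bond d (towerP L m (n + 1)) => (1 : 𝔸ˣ)⁻¹) (Δ₁ := hessOp φ η (fun _ : Bond d (towerP L m (n + 1)) => (1 : 𝔸ˣ)) τ)
              (Rr := RofUk L m n φ η (fun _ : Bond d (towerP L m (n + 1)) => (1 : 𝔸ˣ)))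
              (Q := (QkW L m n φ (fun _ : Bond d (towerP L m (n + 1)) => (1 : 𝔸ˣ)) hL (fun _ => 0) (fun _ => by norm_num)
                (perCfg_UlevOf_one_mem_U1 L m (n + 1)) (norm_Wcx_UlevOf_one_sub_one_le L m (n + 1) (fun _ => 0) (fun _ => le_rfl)) (c₀ := c₀) (c₁ := c₁))) (a := a)
              φ hpos₁ (QkW_one_surjective L m hL n φ) (fun _ : Bond d (towerP L m (n + 1)) × Fin d => n + 1) (nabla115 η (fun _ : Bond d (towerP L m (n + 1)) => (1 : 𝔸ˣ)))) 0
              (Cck L m η (n + 1) (fun _ : Bond d (towerP L m (n + 1)) => (1 : 𝔸ˣ)) (fun _ : Bond d (towerP L m (n + 1)) => n + 1) (fun _ : Bond d (towerP L m (n + 1)) × Fin d => n + 1) (nabla115 η (fun _ : Bond d (towerP L m (n + 1)) => (1 : 𝔸ˣ))) levB) 0 εC A') ε₄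
            (H1LatticeCLM (L := (L : ℝ)) (η := η) (lev₀ := (fun _ : Bond d (towerP L m (n + 1)) => n + 1)) (levB := levB) (c := ((η : ℂ))⁻¹)
              (R := adTransportW φ (fun _ : Bond d (towerP L m (n + 1)) => (1 : 𝔸ˣ)))
              (S := adTransportW φ fun _ : Bond d (towerP L m (n + 1)) => (1 : 𝔸ˣ)⁻¹) (Δ₁ := hessOp φ η (fun _ : Bond d (towerP L m (n + 1)) => (1 : 𝔸ˣ)) τ)
              (Rr := RofUk L m n φ η (fun _ : Bond d (towerP L m (n + 1)) => (1 : 𝔸ˣ)))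
              (Q := (QkW L m n φ (fun _ : Bond d (towerP L m (n + 1)) => (1 : 𝔸ˣ)) hL (fun _ => 0) (fun _ => by norm_num)
                (perCfg_UlevOf_one_mem_U1 L m (n + 1)) (norm_Wcx_UlevOf_one_sub_one_le L m (n + 1) (fun _ => 0) (fun _ => le_rfl)) (c₀ := c₀) (c₁ := c₁))) (a := a)
              φ hpos₁ (QkW_one_surjective L m hL n φ) (fun _ : Bond d (towerP L m (n + 1)) × Fin d => n + 1) (nabla115 η (fun _ : Bond d (towerP L m (n + 1)) => (1 : 𝔸ˣ)))) →
        (DifferentiableOn ℂ ΦU (ball (0 : NegSize (L : ℝ) η levB 0 𝔸) Rb) ∧ MapsTo ΦU (ball (0 : NegSize (L : ℝ) η levB 0 𝔸) Rb)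
          (ball (0 : Space115 (L : ℝ) η (fun _ : Bond d (towerP L m (n + 1)) => n + 1) (fun _ : Bond d (towerP L m (n + 1)) × Fin d => n + 1) (nabla115 η U)) R') ∧ ΦU 0 = 0) ∧
        (DifferentiableOn ℂ Φ1 (ball (0 : NegSize (L : ℝ) η levB 0 𝔸) Rb) ∧ MapsTo Φ1 (ball (0 : NegSize (L : ℝ) η levB 0 𝔸) Rb)
          (ball (0 : Space115 (L : ℝ) η (fun _ : Bond d (towerP L m (n + 1)) => n + 1) (fun _ : Bond d (towerP L m (n + 1)) × Fin d => n + 1) (nabla115 η (fun _ : Bond d (towerP L m (n + 1)) => (1 : 𝔸ˣ)))) R') ∧ Φ1 0 = 0) ∧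
        ∀ (B : NegSize (L : ℝ) η levB 0 𝔸), ‖B‖ < Rb →
          ‖LinearMap.toContinuousLinearMap
              ((jetLinearEquiv (L : ℝ) η (fun _ : Bond d (towerP L m (n + 1)) => n + 1) (fun _ : Bond d (towerP L m (n + 1)) × Fin d => n + 1) (nabla115 η (fun _ : Bond d (towerP L m (n + 1)) => (1 : 𝔸ˣ)))).symm.toLinearMap ∘ₗ
                (jetLinearEquiv (L : ℝ) η (fun _ : Bond d (towerP L m (n + 1)) => n + 1) (fun _ : Bond d (towerP L m (n + 1)) × Fin d => n + 1) (nabla115 η U)).toLinearMap) (ΦU B) - Φ1 B‖ ≤ K * (j₀ + α) := by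
  obtain ⟨α₁, j₁, ε₄, εC, Rb, R', K, hα₁, hj₁, hε₄, hεC, hRb, hR', hK, HC⟩ :=
    cur_chart_tower_pi_one_chart_of_unitary_class_lattice_uniform_W80 hd L hL hL2 hL3 φ hMφ hMφ' hφ hφ' ha ha' τ hτ hCτ hτm hMτ hρw hτ₁ hτ₂ hφτ hα₀ hα3 hα4 hα8 hαL
      hρ0 hρ hρ4 hθ hC3 hCτ1 (le_refl (1 : ℝ)) (le_refl (1 : ℝ)) hr' h7s' h7c' h7r'1 h7s h7c h7β h7E h7dX
  refine ⟨α₁, j₁, ε₄, εC, Rb, R', K, hα₁, hj₁, hε₄, hεC, hRb, hR', hK, ?_⟩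
  intro n η _ hηL c₀ c₁ _ _ hw hc₀η hρ' m _ hm U hUG α hα0 hαle hUη hUw hpl hUgrad j₀ hJ hj' levB
  have hw1 := topLevel_weights (ι := Bond d (towerP L m (n + 1))) (L := (L : ℝ)) hηL 1
  have hw2 := topLevel_weights (ι := Bond d (towerP L m (n + 1)) × Fin d) (L := (L : ℝ)) hηL 2
  have hw3 := topLevel_weights (ι := Bond d (towerP L m (n + 1))) (L := (L : ℝ)) hηL 3
  have hwB := zeroExp_weights (L := (L : ℝ)) (η := η) levB
  exact HC n η hηL c₀ c₁ hw hc₀η hρ' m hm U hUG α hα0 hαle hUη hUw hpl hUgrad j₀ hJ hj' (fun _ => n + 1) (fun _ => n + 1) levB (fun _ => le_rfl)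
    hw1.1 hw2.1 hw3.2 hwB hw2.2

end Summit.QuantumFields.BalabanUV.T4Continuum.NE9CurChartTowerPiOneChartClassW80TopLevel

end
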